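import Summits.CriticalPhenomena.SAWScalingLimit.Theses.SAWDiscreteFlowLine
import Literature.Probability.RandomPlanarGeometry.SLEConvergenceCriterion
import Literature.Probability.RandomPlanarGeometry.SLEUniquenessInLaw
/-!
# Birth skeleton (`Lines/birth.lean`) for crux `LatticeFlowLine` (stmt-CriticalPhenomena-8240)

Route `SAWDiscreteFlowLine` of `CriticalPhenomena/SAWScalingLimit`, crux r2 (L):
"the lattice GFF has a κ = 8/3 flow line" — for every Dobrushin domain `(D; a, b)`, endpoint
approximation `(a_δ, b_δ)` and chordal uniformizer `φ` there is a field-measurable family of lattice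
paths `F_δ(h)` of `Ω_δ ⊆ δℤ²` from `a_δ` to `b_δ` which, under every family `P_δ` of zero-Dirichlet
face-DGFF laws, (i) converges in law to chordal SLE_{8/3} in `D` and (ii) DRESSES THE FIELD WELL
(the conditional characteristic function of `κ₀⟨h, ψ⟩_δ` given any prefix is that of
`N(⟨U^{prefix}, ψ⟩_δ, (π/2)⟨ψ, G_slit ψ⟩_δ)` up to `o(1)`, `U^{prefix}` the discrete-harmonic
flow-line dressing with λ′ = π/√6, χ = 1/√6, λ = π√(3/8)).

## The line — the route header's own two-layer plan, typed in ∃-form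
`LatticeFlowLine ⇐ TiltedExplorationConverges → TiltedExplorationDresses` (route header, TWO-LAYER
PLAN) becomes, without naming the witness (its definition, D2 `TiltedLevelLineExploration`, has not
landed), the Duminil-Copin–Smirnov shape "tightness + identification of subsequential limits +
uniqueness of the limit" (DCS12, proof of Thm 3.13) applied to the Gaussian explorer:

* `stub_dressedExplorer : DressedExplorer` (XL, HARDEST) — LATTICE half: there is a family `F_δ`,
  eventually valued in frozen vertex sequences of SELF-AVOIDING lattice paths from `a_δ` to `b_δ`
  (`IsSP`, strengthening the crux's `IsDP`), such that under every face-DGFF family the curves are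
  eventually a.e.-measurable and TIGHT along the mesh (`IsTightAlongMesh`) and `F` dresses the field
  well (clause (ii) verbatim). Content: tilted height gap + narrows/RSW for an interface at a moving
  level (Schramm–Sheffield 2009 at χ = 0).
* `stub_dressingIdentifiesSLE : DressingIdentifiesSLE` (XL) — CONTINUUM half: for ANY eventually
  simple-path-valued, eventually measurable, well-dressing family, every probability subsequential
  weak limit law of the curves is the chordal SLE_{8/3} law (`IsSLELaw (8/3) D μ`). Content:
  lattice-to-continuum passage of the dressing + flow-line rigidity (IG-I Thm 1.1–1.2, Dubédat).
* `LatticeFlowLine_of` (kernel-checked, no `sorry`): `IsSP → IsDP`, clause (ii) from stub A, and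
  clause (i) by the file's sorry-free `convergesInLawToSLE_of_eventually_isProbabilityMeasure` —
  the tree's PROVED criterion `convergesInLawToSLE_of_isTightAlongMesh` (Prokhorov + subsequence
  principle) with the PROVED uniqueness fact `IsSLECurve.map_eq_holds`, after patching the DGFF
  family to probability measures for all `δ` (only its germ at `0⁺` matters) — concluding the crux
  BY NAME.

Why the split is not a shred: stub A alone does not give (i) (no identification: a tight
well-dressed family might converge to another law only if flow-line rigidity failed — that is
exactly stub B's content), stub B alone has no witness; neither mentions the SAW, so neither gives
the conjunct `SAWScalingLimit` (BC3 probes in `bc/`, all FAIL). The simple-path clause `IsSP` is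
what makes stub B honest: with the crux's `IsDP` (walks) the padding `ω ↦ ω ++ ω⁻¹ ++ ω` of a
well-dressing family keeps the dressing and converges to a thrice-traced SLE (refuter of
stmt-8241), so "dressing identifies the limit" must be asked of simple paths.

## Disproof / negatives used
* `Cruxes/LatticeFlowLine/Disproof.lean`: none exists (`ledger crux ls stmt-CriticalPhenomena-8240`:
  no workfiles, 2026-08-17) — no `_false_without_` obstruction to honour, no landed Negative lemma.
* `ledger negatives --problem CriticalPhenomena`: the all-δ SAW tightness refutation (stmt-0772) is
  not touched — tightness here is `IsTightAlongMesh` (eventual, along `𝓝[>] 0`) and concerns the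
  Gaussian explorer, not the SAW; the stmt-8241 padding twist is designed out by `IsSP`.
-/

noncomputable section

open scoped BigOperators Topology Manifold Classical MeasureTheory ProbabilityTheory Matrix InnerProductSpace ComplexConjugate ContinuousMap
open Filter Set Function TopologicalSpace MeasureTheory

namespace Summit.CriticalPhenomena.SAWScalingLimit.Cruxes.LatticeFlowLine.Birth

/-! ### 1. The two stub statements (same `let`-preamble as the crux) -/

/-- STUB A statement — **the face DGFF of `Ω_δ` admits a tight, well-dressed SIMPLE explorer**
(the LATTICE half of Schramm–Sheffield's scheme for the χ-tilted level line, in ∃-form; the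
route's named witness is the χ-tilted level-line exploration, definition request D2 /
informal item DiscreteFlowLine). Same `let`-preamble as the crux (face domain `Fc`, walk-sum Green
function `Gf`, exit law `Hm`, side faces `lf/rf`, first adjacency `jf`, √δ-chords `pt/ang`,
flow-line data `dat` with λ′ = π/√6, χ = 1/√6, λ = π√(3/8), dressing `U`, pairings `pr/Qv`, DGFF
characteristic functional `gff`, dressing defect `dfc/dft`, polyline class `crv`), plus
`IsSP δ v`: `v` is the frozen vertex sequence of a SELF-AVOIDING lattice path (`Walk.IsPath`) of
`Ω_δ` from `a_δ` to `b_δ` (strengthening the crux's `IsDP`, which admits non-simple walks — the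
padding twist recorded by the refuter of stmt-CriticalPhenomena-8241). Statement: for every
Dobrushin domain, endpoint approximation and chordal uniformizer `φ` there is a family
`F_δ : (faces → ℝ) → vertex sequences`, eventually `IsSP`-valued, such that for every family
`P_δ` of face-DGFF laws: (a) `h ↦ curve(F_δ h)` is eventually a.e.-measurable, (b) the curve
laws are TIGHT along the mesh (`IsTightAlongMesh` — a-priori crossing estimates for an interface
at a moving level: SS09's narrows lemma, Aizenman–Burchard / Kemppainen–Smirnov), and (c) `F`
DRESSES THE FIELD WELL — clause (ii) of the crux verbatim (the tilted height-gap lemma with the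
imaginary-geometry constants of κ = 8/3). -/
def DressedExplorer : Prop :=
  ∀ (D : Literature.Probability.RandomPlanarGeometry.DobrushinDomain) a b, Literature.Probability.RandomPlanarGeometry.SAW.IsEndpointApprox D a b → ∀ φ, D.IsChordalUniformizing φ →
    let S : Type := Literature.Probability.LatticeModels.Site 2;
    let pi := Real.pi;
    let sq := Real.sqrt;
    let I := Complex.I;
    let ex := Complex.exp;
    let ar := Complex.arg;
    let mp := Literature.Probability.LatticeModels.meshPoint;
    let Ad := fun δ (x y : S) => (Literature.Probability.LatticeModels.discreteDomainGraph D.carrier δ).Adj x y;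
    let Fc := fun δ => {f : S | Ad δ f (f + ![1,0]) ∧ Ad δ f (f + ![0,1]) ∧ Ad δ (f + ![1,0]) (f + ![1,1]) ∧ Ad δ (f + ![0,1]) (f + ![1,1])};
    let ctr := fun δ f => mp δ f + (δ : ℂ) * (1 + I) / 2;
    let Gf := fun (A : Set S) f g => ∑' ω : (Literature.Probability.LatticeModels.zdGraph 2).Walk f g, if (∀ x ∈ ω.support, x ∈ A) then ((4 : ℝ)⁻¹) ^ ω.length else 0;
    let Hm := fun A (z f : S) => (Gf A z (f + ![1,0]) + Gf A z (f + ![-1,0]) + Gf A z (f + ![0,1]) + Gf A z (f + ![0,-1])) / 4;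
    let lf := fun (x y : S) => if y = x + ![1,0] then x else if y = x + ![0,1] then x + ![-1,0] else if y = x + ![-1,0] then x + ![-1,-1] else x + ![0,-1];
    let rf := fun (x y : S) => if y = x + ![1,0] then x + ![0,-1] else if y = x + ![0,1] then x else if y = x + ![-1,0] then x + ![-1,0] else x + ![-1,-1];
    let Ed := fun (v : ℕ → S) i f => v (i + 1) ≠ v i ∧ (f = lf (v i) (v (i + 1)) ∨ f = rf (v i) (v (i + 1)));
    let K := fun v => {f | ∃ i, Ed v i f};
    let jf := fun v f => sInf {i | Ed v i f};
    let bl := fun (δ : ℝ) => ⌈(sq δ)⁻¹⌉₊;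
    let pt := fun δ (v : ℕ → S) i => φ.symm (mp δ (v (bl δ * i)));
    let ang := fun δ v B => pi / 2 + ar ((pt δ v 1 - pt δ v 0) / I) + ∑ i ∈ Finset.range B, ar ((pt δ v (i + 2) - pt δ v (i + 1)) / (pt δ v (i + 1) - pt δ v i));
    let dat := fun δ v f => (if f = lf (v (jf v f)) (v (jf v f + 1)) then -1 else 1) * (pi / sq 6) + (1 / sq 6) * (ang δ v (jf v f / bl δ) - pi / 2) - pi * sq (3 / 8) + 2 * sq (3 / 8) * ar (φ.symm (ctr δ f));
    let U := fun δ v z => ∑' f : S, if f ∈ K v then Hm (Fc δ \ K v) z f * dat δ v f else 0;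
    let pr := fun (δ : ℝ) (ψ : ℂ → ℝ) (w : S → ℝ) => ∑' f : S, if f ∈ Fc δ then δ ^ 2 * ψ (ctr δ f) * w f else 0;
    let Qv := fun (δ : ℝ) (ψ : ℂ → ℝ) (A : Set S) => ∑' f : S, ∑' g : S, if f ∈ Fc δ ∧ g ∈ Fc δ then δ ^ 4 * ψ (ctr δ f) * ψ (ctr δ g) * Gf A f g else 0;
    let gff := fun (δ : ℝ) (μ : Measure (S → ℝ)) => IsProbabilityMeasure μ ∧ ∀ t : S →₀ ℝ, ∫ h, ex (I * ((∑ f ∈ t.support, t f * h f : ℝ) : ℂ)) ∂μ = ex (-((∑ f ∈ t.support, ∑ g ∈ t.support, t f * t g * Gf (Fc δ) f g : ℝ) : ℂ) / 2);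
    let dfc := fun δ ψ s v h => ex (I * (s * sq (pi / 2) * pr δ ψ h : ℝ)) - ex (I * (s * pr δ ψ (U δ v) : ℝ) - ((s ^ 2 * (pi / 2) * Qv δ ψ (Fc δ \ K v) / 2 : ℝ) : ℂ));
    let dft := fun δ ψ s (ι : Type) (pre : ι → ℕ → ℕ → S) (Kr : ι → Measure (S → ℝ)) => sSup {r : ℝ | ∃ (k : ℕ) (F : (ℕ → S) → ℝ), (∀ v, |F v| ≤ 1) ∧ r = ‖∑' ξ : ι, ∫ h, (F (pre ξ k) : ℂ) * dfc δ ψ s (pre ξ k) h ∂(Kr ξ)‖};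
    let len := fun (v : ℕ → S) => sInf {n : ℕ | ∀ i, n ≤ i → v i = v n};
    let crv := fun δ v => Literature.Probability.RandomPlanarGeometry.CurveClass.mk ⟨Literature.Probability.LatticeModels.polyline ((List.range (len v + 1)).map (mp δ ∘ v))⟩;
    let IsSP := fun δ v => ∃ ω : (Literature.Probability.LatticeModels.discreteDomainGraph D.carrier δ).Walk (a δ) (b δ), ω.IsPath ∧ v = fun i => ω.getVert i;
    ∃ F : ℝ → (S → ℝ) → (ℕ → S),
      (∀ᶠ δ in (𝓝[>] 0), ∀ h, IsSP δ (F δ h)) ∧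
      ∀ P : ℝ → Measure (S → ℝ), (∀ᶠ δ in (𝓝[>] 0), gff δ (P δ)) →
        (∀ᶠ δ in (𝓝[>] 0), AEMeasurable (fun h => crv δ (F δ h)) (P δ)) ∧
        Literature.Probability.RandomPlanarGeometry.IsTightAlongMesh (fun δ h => crv δ (F δ h)) P ∧
        ∀ (ψ : ℂ → ℝ) s, Continuous ψ → HasCompactSupport ψ → tsupport ψ ⊆ D.carrier → Tendsto (fun δ => dft δ ψ s (ℕ → S) (fun v k i => v (min i k)) (fun v => (P δ).restrict (F δ ⁻¹' {v}))) (𝓝[>] 0) (𝓝 0)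

/-- STUB B statement — **well-dressed simple lattice paths can only converge to SLE_{8/3}**
(the CONTINUUM half: lattice-to-continuum passage of the dressing + flow-line rigidity,
Miller–Sheffield IG-I Thm 1.1 (uniqueness of the flow-line coupling law) and Thm 1.2 (flow lines
are determined by the field), Dubédat 2009; at χ = 0 this is Schramm–Sheffield 2009 §§1.4, 4–5).
Statement: for every Dobrushin domain, endpoint approximation, chordal uniformizer `φ`, every
family `F_δ` eventually valued in frozen vertex sequences of self-avoiding lattice paths of `Ω_δ`
from `a_δ` to `b_δ`, and every family `P_δ` of face-DGFF laws under which `h ↦ curve(F_δ h)` is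
eventually a.e.-measurable and `F` dresses the field well (clause (ii) of the crux verbatim):
every probability subsequential weak limit law `μ` of the curves `curve(F_δ h)`, `h ∼ P_δ`,
`δ → 0⁺` (`IsSubseqLimitLaw`) is the chordal SLE_{8/3} law of `(D; a, b)` (`IsSLELaw (8/3) D μ`).
No tightness hypothesis (a subsequential limit is given); identification only. -/
def DressingIdentifiesSLE : Prop :=
  ∀ (D : Literature.Probability.RandomPlanarGeometry.DobrushinDomain) a b, Literature.Probability.RandomPlanarGeometry.SAW.IsEndpointApprox D a b → ∀ φ, D.IsChordalUniformizing φ →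
    let S : Type := Literature.Probability.LatticeModels.Site 2;
    let pi := Real.pi;
    let sq := Real.sqrt;
    let I := Complex.I;
    let ex := Complex.exp;
    let ar := Complex.arg;
    let mp := Literature.Probability.LatticeModels.meshPoint;
    let Ad := fun δ (x y : S) => (Literature.Probability.LatticeModels.discreteDomainGraph D.carrier δ).Adj x y;
    let Fc := fun δ => {f : S | Ad δ f (f + ![1,0]) ∧ Ad δ f (f + ![0,1]) ∧ Ad δ (f + ![1,0]) (f + ![1,1]) ∧ Ad δ (f + ![0,1]) (f + ![1,1])};
    let ctr := fun δ f => mp δ f + (δ : ℂ) * (1 + I) / 2;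
    let Gf := fun (A : Set S) f g => ∑' ω : (Literature.Probability.LatticeModels.zdGraph 2).Walk f g, if (∀ x ∈ ω.support, x ∈ A) then ((4 : ℝ)⁻¹) ^ ω.length else 0;
    let Hm := fun A (z f : S) => (Gf A z (f + ![1,0]) + Gf A z (f + ![-1,0]) + Gf A z (f + ![0,1]) + Gf A z (f + ![0,-1])) / 4;
    let lf := fun (x y : S) => if y = x + ![1,0] then x else if y = x + ![0,1] then x + ![-1,0] else if y = x + ![-1,0] then x + ![-1,-1] else x + ![0,-1];
    let rf := fun (x y : S) => if y = x + ![1,0] then x + ![0,-1] else if y = x + ![0,1] then x else if y = x + ![-1,0] then x + ![-1,0] else x + ![-1,-1];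
    let Ed := fun (v : ℕ → S) i f => v (i + 1) ≠ v i ∧ (f = lf (v i) (v (i + 1)) ∨ f = rf (v i) (v (i + 1)));
    let K := fun v => {f | ∃ i, Ed v i f};
    let jf := fun v f => sInf {i | Ed v i f};
    let bl := fun (δ : ℝ) => ⌈(sq δ)⁻¹⌉₊;
    let pt := fun δ (v : ℕ → S) i => φ.symm (mp δ (v (bl δ * i)));
    let ang := fun δ v B => pi / 2 + ar ((pt δ v 1 - pt δ v 0) / I) + ∑ i ∈ Finset.range B, ar ((pt δ v (i + 2) - pt δ v (i + 1)) / (pt δ v (i + 1) - pt δ v i));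
    let dat := fun δ v f => (if f = lf (v (jf v f)) (v (jf v f + 1)) then -1 else 1) * (pi / sq 6) + (1 / sq 6) * (ang δ v (jf v f / bl δ) - pi / 2) - pi * sq (3 / 8) + 2 * sq (3 / 8) * ar (φ.symm (ctr δ f));
    let U := fun δ v z => ∑' f : S, if f ∈ K v then Hm (Fc δ \ K v) z f * dat δ v f else 0;
    let pr := fun (δ : ℝ) (ψ : ℂ → ℝ) (w : S → ℝ) => ∑' f : S, if f ∈ Fc δ then δ ^ 2 * ψ (ctr δ f) * w f else 0;
    let Qv := fun (δ : ℝ) (ψ : ℂ → ℝ) (A : Set S) => ∑' f : S, ∑' g : S, if f ∈ Fc δ ∧ g ∈ Fc δ then δ ^ 4 * ψ (ctr δ f) * ψ (ctr δ g) * Gf A f g else 0;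
    let gff := fun (δ : ℝ) (μ : Measure (S → ℝ)) => IsProbabilityMeasure μ ∧ ∀ t : S →₀ ℝ, ∫ h, ex (I * ((∑ f ∈ t.support, t f * h f : ℝ) : ℂ)) ∂μ = ex (-((∑ f ∈ t.support, ∑ g ∈ t.support, t f * t g * Gf (Fc δ) f g : ℝ) : ℂ) / 2);
    let dfc := fun δ ψ s v h => ex (I * (s * sq (pi / 2) * pr δ ψ h : ℝ)) - ex (I * (s * pr δ ψ (U δ v) : ℝ) - ((s ^ 2 * (pi / 2) * Qv δ ψ (Fc δ \ K v) / 2 : ℝ) : ℂ));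
    let dft := fun δ ψ s (ι : Type) (pre : ι → ℕ → ℕ → S) (Kr : ι → Measure (S → ℝ)) => sSup {r : ℝ | ∃ (k : ℕ) (F : (ℕ → S) → ℝ), (∀ v, |F v| ≤ 1) ∧ r = ‖∑' ξ : ι, ∫ h, (F (pre ξ k) : ℂ) * dfc δ ψ s (pre ξ k) h ∂(Kr ξ)‖};
    let len := fun (v : ℕ → S) => sInf {n : ℕ | ∀ i, n ≤ i → v i = v n};
    let crv := fun δ v => Literature.Probability.RandomPlanarGeometry.CurveClass.mk ⟨Literature.Probability.LatticeModels.polyline ((List.range (len v + 1)).map (mp δ ∘ v))⟩;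
    let IsSP := fun δ v => ∃ ω : (Literature.Probability.LatticeModels.discreteDomainGraph D.carrier δ).Walk (a δ) (b δ), ω.IsPath ∧ v = fun i => ω.getVert i;
    ∀ F : ℝ → (S → ℝ) → (ℕ → S), (∀ᶠ δ in (𝓝[>] 0), ∀ h, IsSP δ (F δ h)) →
      ∀ P : ℝ → Measure (S → ℝ), (∀ᶠ δ in (𝓝[>] 0), gff δ (P δ)) →
        (∀ᶠ δ in (𝓝[>] 0), AEMeasurable (fun h => crv δ (F δ h)) (P δ)) →
        (∀ (ψ : ℂ → ℝ) s, Continuous ψ → HasCompactSupport ψ → tsupport ψ ⊆ D.carrier → Tendsto (fun δ => dft δ ψ s (ℕ → S) (fun v k i => v (min i k)) (fun v => (P δ).restrict (F δ ⁻¹' {v}))) (𝓝[>] 0) (𝓝 0)) →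
        ∀ μ : Measure (Literature.Probability.RandomPlanarGeometry.CurveClass ℂ), IsProbabilityMeasure μ →
          Literature.Probability.RandomPlanarGeometry.IsSubseqLimitLaw (fun δ h => crv δ (F δ h)) P μ →
          Literature.Probability.RandomPlanarGeometry.IsSLELaw ((8 : NNReal) / 3) D μ

/-! ### 2. Sorry-free glue: the convergence criterion for an EVENTUALLY-probability family

The crux pins the DGFF laws `P δ` only eventually along `𝓝[>] 0` (`∀ᶠ δ, gff δ (P δ)`), while
the tree's criterion `convergesInLawToSLE_of_isTightAlongMesh` (Prokhorov + subsequence principle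
+ uniqueness of the SLE law, PROVED, with the uniqueness fact `IsSLECurve.map_eq_holds` PROVED in
`SLEUniquenessInLaw.lean`) carries the instance `[∀ δ, IsProbabilityMeasure (P δ)]`. Only the
germ of `P` at `0⁺` matters for tightness, subsequential limits and convergence in law, so we
patch `P` by a fixed probability measure away from the eventual range. -/

section Glue

open Literature.Probability.RandomPlanarGeometry

/-- **Tightness + identification of subsequential limits ⇒ convergence in law to SLE_κ**, for a
family of laws that are probability measures only for small meshes. (Duminil-Copin–Smirnov 2012,
proof of Thm 3.13; Billingsley 1999, Thm 5.1 and Corollary — via the tree's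
`convergesInLawToSLE_of_isTightAlongMesh` and `IsSLECurve.map_eq_holds`.) -/
theorem convergesInLawToSLE_of_eventually_isProbabilityMeasure
    {Ω : Type*} [MeasurableSpace Ω] {κ : NNReal} {D : DobrushinDomain}
    {Y : ℝ → Ω → CurveClass ℂ} {P : ℝ → Measure Ω}
    (hP : ∀ᶠ δ in 𝓝[>] (0 : ℝ), IsProbabilityMeasure (P δ))
    (hY : ∀ᶠ δ in 𝓝[>] (0 : ℝ), AEMeasurable (Y δ) (P δ))
    (hT : IsTightAlongMesh Y P)
    (hL : ∀ μ : Measure (CurveClass ℂ), IsProbabilityMeasure μ → IsSubseqLimitLaw Y P μ →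
      IsSLELaw κ D μ) :
    ConvergesInLawToSLE κ D Y P := by
  obtain ⟨δ₀, hδ₀⟩ := hP.exists
  -- patch the laws outside the eventual range by the probability measure `P δ₀`
  obtain ⟨P', hP', hPP'⟩ : ∃ P' : ℝ → Measure Ω, (∀ δ, IsProbabilityMeasure (P' δ)) ∧
      ∀ᶠ δ in 𝓝[>] (0 : ℝ), P' δ = P δ := by
    refine ⟨fun δ => if IsProbabilityMeasure (P δ) then P δ else P δ₀, fun δ => ?_,
      hP.mono fun δ hδ => if_pos hδ⟩
    dsimp only
    split_ifs with h
    exacts [h, hδ₀]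
  haveI : ∀ δ, IsProbabilityMeasure (P' δ) := hP'
  have hY' : ∀ᶠ δ in 𝓝[>] (0 : ℝ), AEMeasurable (Y δ) (P' δ) := by
    filter_upwards [hY, hPP'] with δ h1 h2
    rw [h2]; exact h1
  have hT' : IsTightAlongMesh Y P' := by
    intro ε hε
    obtain ⟨K, hK, hev⟩ := hT ε hε
    refine ⟨K, hK, ?_⟩
    filter_upwards [hev, hPP'] with δ h1 h2
    rw [h2]; exact h1
  have hL' : ∀ μ : Measure (CurveClass ℂ), IsProbabilityMeasure μ → IsSubseqLimitLaw Y P' μ →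
      IsSLELaw κ D μ := by
    rintro μ hμ ⟨s, hs, hlim⟩
    refine hL μ hμ ⟨s, hs, fun f => (hlim f).congr' ?_⟩
    filter_upwards [hs.eventually hPP'] with n hn
    rw [hn]
  obtain ⟨Γ, hΓ, -, hTL⟩ :=
    convergesInLawToSLE_of_isTightAlongMesh (κ := κ) (D := D) IsSLECurve.map_eq_holds hY' hT' hL'
  refine ⟨Γ, hΓ, hY, fun f => (hTL f).congr' ?_⟩
  filter_upwards [hPP'] with δ hδ
  rw [hδ]

end Glue

/-! ### 3. The registered stubs (the only `sorry`s of the file) -/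

/-- STUB A (XL, HARDEST — carries the crux's typed risk): the lattice GFF admits a tight,
well-dressed simple explorer at the IG constants of κ = 8/3. Why plausibly true: at χ = 0 it is
Schramm–Sheffield 2009 (height gap λ_TG = π/2 in MS units + narrows ⇒ tightness and the
martingale/dressing property of the zero level line); Miller–Sheffield's discretised rays
(IG-I p. 6, Fig. 1.2) are the numerics for χ ≠ 0. Why it might fail (the crux's own): at χ ≠ 0 the
interface sits at a level moving ±πχ/2 per turn against the gap λ′; the renormalised tilted gap
may be direction-dependent on ℤ² (staircase bias), leaving no isotropic dressing for ANY lattice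
witness. -/
theorem stub_dressedExplorer : DressedExplorer := by
  sorry

/-- STUB B (XL): identification — every probability subsequential limit of a well-dressed,
eventually measurable family of SIMPLE lattice paths under the face DGFF is the chordal SLE_{8/3}
law. Why plausibly true: joint subsequential limits `(η, h)` of well-dressing couplings are
imaginary-geometry couplings (the lattice dressing `U^{prefix}` — discrete harmonic extension of
`∓λ′ + χ·(ℍ-angle of √δ-chords) − λ + (2λ/π) Arg φ⁻¹` — converges to the continuum flow-line
harmonic function along converging prefixes), and in any such coupling `η` is the SLE_κ flow line
with `χ = 2/√κ − √κ/2`, i.e. κ = 8/3 (IG-I Thm 1.1–1.2, Dubédat 2009). Why it might fail: IG-I's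
uniqueness is for continuous paths with the conditional-law property at ALL stopping times and a
Loewner description; sup-norm subsequential limits of simple lattice paths may retrace or hug the
boundary, and weak ψ-testing of the dressing at lattice prefix times must be upgraded to
continuum stopping times (Beurling-type control of the √δ-chord winding near the tip). -/
theorem stub_dressingIdentifiesSLE : DressingIdentifiesSLE := by
  sorry

/-! ### Name-keyed aliases of the stub statements (hypotheses of the composition)

`Registered.stub_X : Prop` is the statement of `stub_X` under the registered stub's short name, so
that the skeleton audit (`#h21_check_skeleton`: hypotheses admissible iff registered stubs BY NAME)
accepts `LatticeFlowLine_of : Registered.stub_… → … → LatticeFlowLine` (device of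
`Cruxes/ChainLaw/Lines/birth.lean`, `Cruxes/DrivingIdentification/Lines/birth.lean`). -/
namespace Registered

/-- Alias keyed by the registered stub name. -/
abbrev stub_dressedExplorer : Prop := DressedExplorer
/-- Alias keyed by the registered stub name. -/
abbrev stub_dressingIdentifiesSLE : Prop := DressingIdentifiesSLE

end Registered

/-! ### 4. The composition (kernel-checked, no `sorry`) -/

/-- **The two stubs imply the crux `LatticeFlowLine` BY NAME.** Fix `(D; a, b)`, the endpoint
approximation and the uniformizer `φ`; take the explorer `F` of stub A (a self-avoiding lattice
path is in particular a walk of `Ω_δ` from `a_δ` to `b_δ`, so the crux's `IsDP` clause holds);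
for a face-DGFF family `P`: clause (ii) (dressing) is stub A (c) verbatim, and clause (i)
(convergence in law to chordal SLE_{8/3}, measurability included) follows from eventual
a.e.-measurability (A(a)), tightness (A(b)), identification of the subsequential limits (stub B)
and uniqueness of the chordal SLE law (tree, PROVED) through
`convergesInLawToSLE_of_eventually_isProbabilityMeasure` (the DGFF laws are probability measures
eventually, by `gff`). -/
theorem LatticeFlowLine_of (hA : Registered.stub_dressedExplorer)
    (hB : Registered.stub_dressingIdentifiesSLE) :
    Summit.CriticalPhenomena.SAWScalingLimit.Theses.SAWDiscreteFlowLine.LatticeFlowLine := by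
  intro D a b hab φ hφ
  obtain ⟨F, hSP, hF⟩ := hA D a b hab φ hφ
  refine ⟨F, hSP.mono fun δ hδ h => ?_, fun P hgff => ?_⟩
  · obtain ⟨ω, -, hω⟩ := hδ h
    exact ⟨ω, hω⟩
  · obtain ⟨hY, hT, hdress⟩ := hF P hgff
    refine ⟨?_, hdress⟩
    have hP : ∀ᶠ δ in 𝓝[>] (0 : ℝ), IsProbabilityMeasure (P δ) := hgff.mono fun δ hδ => hδ.1
    exact convergesInLawToSLE_of_eventually_isProbabilityMeasure hP hY hT
      (hB D a b hab φ hφ F hSP P hgff hY hdress)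

/-- Wiring check: the registered stubs feed `LatticeFlowLine_of` as stated. -/
example : Summit.CriticalPhenomena.SAWScalingLimit.Theses.SAWDiscreteFlowLine.LatticeFlowLine :=
  LatticeFlowLine_of stub_dressedExplorer stub_dressingIdentifiesSLE

end Summit.CriticalPhenomena.SAWScalingLimit.Cruxes.LatticeFlowLine.Birth

end
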